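import Mathlib
import Summits.ValiantsHypothesis.ValiantsHypothesis.Theses.ContractivityPrice

/-!
# Route ContractivityPrice — support item `QpComposition`

Arithmetic glue for the deciding theorem of route `ContractivityPrice`
(item stmt-ValiantsHypothesis-10588): quasi-polynomial bounds are closed under the
price bound of `PriceOfContractivity`.  For all `c d : ℕ` there is `c'` (we take
`c' = (c + 3) * (d + 1)`) such that
`2 ^ ((log₂ (m + N) + d) ^ d) ≤ 2 ^ ((log₂ n + c') ^ c')` whenever
`m ≤ 2 ^ ((log₂ n + c) ^ c)` and `N ≤ n ^ 2`.

Proof: with `L = Nat.log 2 n` and `S = L + c + d + 3` one has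
`m + N ≤ 2 ^ ((L + c) ^ c) + 2 ^ (2L + 2) ≤ 2 ^ ((L + c) ^ c + 2L + 3)`, hence
`Nat.log 2 (m + N) + d ≤ (L + c) ^ c + 2L + 3 + d ≤ S ^ c + S ^ 2 ≤ S ^ (c + 3)` and
`(Nat.log 2 (m + N) + d) ^ d ≤ S ^ ((c + 3) d) ≤ (L + c') ^ c'`.
Elementary; no literature needed (the route cites Burgisser2000 only for the notion of
quasi-polynomial boundedness).
-/

-- The tree's namespace `Summit.<Summit>.<Problem>` repeats `ValiantsHypothesis` by design (D-0017).
set_option linter.dupNamespace false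

namespace Summit.ValiantsHypothesis.ValiantsHypothesis.Theorems

open Summit.ValiantsHypothesis.ValiantsHypothesis.Theses.ContractivityPrice

/-- Key polylog estimate: with `S = L + c + d + 3`,
`(L + c) ^ c + 2 * L + 3 + d ≤ S ^ (c + 3)`. -/
theorem qpComposition_polylog_bound (L c d : ℕ) :
    (L + c) ^ c + 2 * L + 3 + d ≤ (L + c + d + 3) ^ (c + 3) := by
  set S := L + c + d + 3 with hS
  have hS1 : 1 ≤ S := by omega
  have hS2 : 2 ≤ S := by omega
  have h1 : (L + c) ^ c ≤ S ^ (c + 2) :=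
    calc (L + c) ^ c ≤ S ^ c := Nat.pow_le_pow_left (by omega) c
      _ ≤ S ^ (c + 2) := Nat.pow_le_pow_right hS1 (by omega)
  have h2 : 2 * L + 3 + d ≤ S ^ (c + 2) :=
    calc 2 * L + 3 + d ≤ S * S := by nlinarith
      _ = S ^ 2 := by ring
      _ ≤ S ^ (c + 2) := Nat.pow_le_pow_right hS1 (by omega)
  calc (L + c) ^ c + 2 * L + 3 + d = (L + c) ^ c + (2 * L + 3 + d) := by ring
    _ ≤ S ^ (c + 2) + S ^ (c + 2) := Nat.add_le_add h1 h2
    _ = 2 * S ^ (c + 2) := by ring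
    _ ≤ S * S ^ (c + 2) := Nat.mul_le_mul_right _ hS2
    _ = S ^ (c + 3) := by ring

/-- Logarithm estimate: if `m ≤ 2 ^ A` and `N ≤ n ^ 2` then
`Nat.log 2 (m + N) ≤ A + 2 * Nat.log 2 n + 3`. -/
theorem qpComposition_log_add_le (n m N A : ℕ) (hm : m ≤ 2 ^ A) (hN : N ≤ n ^ 2) :
    Nat.log 2 (m + N) ≤ A + 2 * Nat.log 2 n + 3 := by
  set L := Nat.log 2 n with hL
  have hn : n < 2 ^ (L + 1) := Nat.lt_pow_succ_log_self one_lt_two n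
  have hN' : N ≤ 2 ^ (2 * L + 2) := by
    calc N ≤ n ^ 2 := hN
      _ ≤ (2 ^ (L + 1)) ^ 2 := Nat.pow_le_pow_left hn.le 2
      _ = 2 ^ (2 * L + 2) := by rw [← pow_mul]; ring_nf
  have hA : 2 ^ A ≤ 2 ^ (A + 2 * L + 2) := Nat.pow_le_pow_right two_pos (by omega)
  have hB : 2 ^ (2 * L + 2) ≤ 2 ^ (A + 2 * L + 2) := Nat.pow_le_pow_right two_pos (by omega)
  have hmN : m + N ≤ 2 ^ (A + 2 * L + 3) :=
    calc m + N ≤ 2 ^ A + 2 ^ (2 * L + 2) := Nat.add_le_add hm hN'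
      _ ≤ 2 ^ (A + 2 * L + 2) + 2 ^ (A + 2 * L + 2) := Nat.add_le_add hA hB
      _ = 2 ^ (A + 2 * L + 3) := by ring
  calc Nat.log 2 (m + N) ≤ Nat.log 2 (2 ^ (A + 2 * L + 3)) := Nat.log_mono_right hmN
    _ = A + 2 * L + 3 := Nat.log_pow one_lt_two _

/-- **Item stmt-ValiantsHypothesis-10588 (`QpComposition`), proved.**
Quasi-polynomial bounds compose with the price bound: for all `c d` the witness
`c' = (c + 3) * (d + 1)` satisfies
`2 ^ ((Nat.log 2 (m + N) + d) ^ d) ≤ 2 ^ ((Nat.log 2 n + c') ^ c')`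
whenever `m ≤ 2 ^ ((Nat.log 2 n + c) ^ c)` and `N ≤ n ^ 2`. -/
theorem qpComposition_proof : QpComposition := by
  unfold QpComposition
  intro c d
  refine ⟨(c + 3) * (d + 1), ?_⟩
  intro n m N hm hN
  apply Nat.pow_le_pow_right two_pos
  set L := Nat.log 2 n with hL
  set S := L + c + d + 3 with hS
  have hlog : Nat.log 2 (m + N) ≤ (L + c) ^ c + 2 * L + 3 :=
    qpComposition_log_add_le n m N _ hm hN
  have hY : Nat.log 2 (m + N) + d ≤ S ^ (c + 3) :=
    calc Nat.log 2 (m + N) + d ≤ (L + c) ^ c + 2 * L + 3 + d := by omega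
      _ ≤ S ^ (c + 3) := qpComposition_polylog_bound L c d
  have hSc' : S ≤ L + (c + 3) * (d + 1) := by
    rw [hS]; nlinarith
  have hpos : 0 < L + (c + 3) * (d + 1) := by positivity
  calc (Nat.log 2 (m + N) + d) ^ d ≤ (S ^ (c + 3)) ^ d := Nat.pow_le_pow_left hY d
    _ = S ^ ((c + 3) * d) := by rw [← pow_mul]
    _ ≤ (L + (c + 3) * (d + 1)) ^ ((c + 3) * d) := Nat.pow_le_pow_left hSc' _
    _ ≤ (L + (c + 3) * (d + 1)) ^ ((c + 3) * (d + 1)) :=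
        Nat.pow_le_pow_right hpos (by nlinarith)

end Summit.ValiantsHypothesis.ValiantsHypothesis.Theorems
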